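import Summits.BirchSwinnertonDyer.BirchSwinnertonDyer.Theorems.ClassRecordThreeEulerHalvesAtThreeJetchevHL

/-!
# Route `ClassRecordThree` (rung K2@3), crux 5 `EulerHalvesAtThree` (item 19109, shared by
# `KolyvaginRoadThree`): the CARRIER SPLIT of the Jetchev binder — ONE reading-shaped binder
# `JetchevMaxHL` (Jetchev 2008 Thm. 1.4, `m_∞ ≥ max_q ord₃ c_q`, read at `3 ∥ N`) closes the (ram)
# Tamagawa clauses on every MONO-CARRIER curve; the residue is J₃ on MULTI-CARRIER frames only
# (cell `bsd-stepL`, seat `bsd-stepL-tam3-p1`, session g3; `--supports stmt-BirchSwinnertonDyer-19109 --as helper`)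

HONEST FRAMING. Hypothesis-shaped binders; nothing asserted; no item closes; no census word moves.
`JetchevMaxHL` below is NOT a published theorem: it is Jetchev, Compos. Math. 144 (2008) Thm. 1.4
(`m_∞ ≥ m_max = max_{q ∣ N} ord_p c_q` under Hypothesis (∗) ∋ «`p ∤ N`», p. 812) with «`p ∤ N`»
REPLACED by «`p = 3`, `3 ∥ N`, `ρ̄_{E,3}` onto» — the cell's reading `JET@3|N` (HOME
tam3/MEMO-J3-v0 §3, referee R-J3 PASS *as a reading* for carriers `q ≠ 3`; carrier `q = 3` by the
explicit-root replacement of Jetchev's Lemma 4.3 at `v ∣ 3`, tam3/MEMO-J3-v2 §1 = x11b3's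
`Three/JetchevKummer*.lean` chain modulo printed inputs). It enters every theorem as an explicit
hypothesis, in McCallum's `M_∞` currency on the tree's objects (`Koly.PDiv`, `KolyvaginHeegnerData`).

## What this file does (over files 1–6 of this seat, p419384 … p429303)

Files 5–6 (`…JetchevHL.lean`, `…JetchevEquiv.lean`) compose the crux BY NAME from {J₃ʳ♭, J₃⁰♭, TL₃}
and show the two Jetchev binders are EQUIVALENT to the crux clauses they serve. J₃ at a frame asks
`3^s`-divisibility of every derived Heegner point to depth `t = ord₃ ∏_ℓ c_ℓ(E)` — the SUM of the
local exponents. Jetchev's printed method (and every Kolyvagin-system method in print: Büyükboduk,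
J. Number Theory 2008 = arXiv:0710.3858, Questions 1–2 and §4.2 «a further improvement which shall
include all Tamagawa factors unfortunately escapes our method») yields the MAXIMUM `max_q ord₃ c_q`
only; the sum is known in print only through an anticyclotomic main conjecture (Burungale–Castella–
Grossi–Skinner arXiv:2312.09301 Thm. 2, good ordinary `p > 3`). This file records the split in the
kernel:

* §1 `jetchevDivisibilityRamHL_of_jetchevMaxHL_of_multi` ∕ `…NotRamHL…`: J₃ʳ♭ (resp. J₃⁰♭) ⟸
  `JetchevMaxHL` + the same divisibility asked ONLY on MULTI-CARRIER curves (`∀ v, ord₃ c_v(E) <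
  ord₃ ∏c(E)`), by a case split on `∃ v, ord₃ ∏c ≤ ord₃ c_v` (on a mono-carrier curve `s ≤ t ≤ ord₃ c_v`
  and the max binder applies at that `v`). Pure bookkeeping: no arithmetic of `∏c` is used.
* §2 the (ram) clauses of the crux on MONO-CARRIER curves from `JetchevMaxHL` ALONE (+ the published
  facts of files 1–5): `missingUpperBoundAt_three_of_classX11b_of_ram_of_monoCarrier_of_jetchevMaxHL`
  (proof = file 5 §1 with the binder applied at the carrier), and the ¬(ram) ∧ surj clause on
  mono-carrier curves from `JetchevMaxHL` + TL₃ (file 5 §2 shape);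
  `eulerHalvesAtThree_monoCarrier_of_jetchevMaxHL_of_twistLower` = the crux's three clauses VERBATIM
  restricted to mono-carrier curves.
* §3 the crux BY NAME (+ the `KolyvaginRoadThree` twin) from the published facts and exactly
  {`JetchevMaxHL`, J₃ʳ♭-multi, J₃⁰♭-multi, TL₃} (file 5 §3 ∘ §1).

So a re-cut of item 19109 along the carrier count is kernel-certified: the reading-grade part is ONE
statement (Jetchev's theorem transported to `3 ∥ N`, all carrier kinds α ∕ β ∕ γ at once), the
open residue is J₃ on multi-carrier Hoffstein–Luo frames (IMC-grade) and TL₃. Census pointer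
(EVIDENCE, x11b3 two-engine count quoted in `Three/TamagawaAdditiveThree.lean`; nothing booked): of
the 567 TRUE-OPEN (T2′)@3 classes, 160 are mono-carrier (α 37 · β 76 · γ 47), 407 multi-carrier.

References: [Jetchev2008] Hypothesis (∗), Thm. 1.4, Cor. 1.5 (p. 812), Prop. 4.9, Thm. 6.3;
[McCallumLMS1991] §5 Cor. 5.6 (p. 310); [Buyukboduk2008Tamagawa] = arXiv:0710.3858, Thm. A–C, §4.2;
[BCGS2023] = arXiv:2312.09301 Thm. 2; [Skinner2016PacificMC] Thm. C; [HoffsteinLuo1997];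
[Darmon2004] Thm. 3.6; cell files `…EulerHalvesAtThreeJetchev{,NotRam,Tight,Necessary,HL,Equiv}.lean`.
-/

noncomputable section

open scoped Classical NumberField

namespace Summit.BirchSwinnertonDyer.Rank1Residual.X11b.Three.Koly

open WeierstrassCurve Literature.NumberTheory.EllipticCurves
  Literature.NumberTheory.EllipticCurves.ModularForms
  Literature.NumberTheory.EllipticCurves.Rank1Residual
  Summit.BirchSwinnertonDyer.Rank1Residual Summit.BirchSwinnertonDyer.Rank1Residual.X11b
  IsDedekindDomain

section Binders

/-! ### §0 The binders (stated once as section hypotheses; every theorem lists the ones it uses) -/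

variable
  -- published named facts (as in files 1–5)
  (hGZ : ∀ (N : ℕ) [NeZero N] (W : WeierstrassCurve ℚ) (K : Type) [Field K] [NumberField K],
    gross_zagier N W K)
  (hKo : ∀ (N : ℕ) [NeZero N] (W : WeierstrassCurve ℚ) (K : Type) [Field K] [NumberField K],
    kolyvagin N W K)
  (hSk : Skinner2016.thmC_padicValRat_bsd_rank_zero)
  (hGZK : rank_eq_analyticRank_of_analyticRank_le_one) (hmod : hasEntireLFunction_rat)
  (hnf : exists_isNewformOf) (hHL : HoffsteinLuo1997_exists_twist_L_one_ne_zero)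
  (hMaz : mazur_not_dvd_maninConstant_of_odd)
  (hrec : ∀ (N : ℕ) [NeZero N] (W : WeierstrassCurve ℚ) (K : Type) [Field K] [NumberField K],
    heegnerPointOfConductor_one_galoisConj N W K)
  (hD36 : ∀ (N : ℕ) [NeZero N] (W : WeierstrassCurve ℚ) (K : Type) [Field K] [NumberField K],
    phi_heegnerTau_mem_singularModuliField N W K)
  (hMcU : McCallum1991_padicValNat_card_sha_primary_add_le_of_globalDivisibility)
  -- OPEN INPUT (reading-shaped) `JetchevMaxHL`: Jetchev 2008 Thm. 1.4 «m_∞ ≥ max_q ord_p c_q» READ at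
  -- p = 3 ∥ N on Hoffstein–Luo-type Manin-good conductor-1 frames: 3^s-divisibility of every derived
  -- Heegner point to every depth s ≤ ord₃ c_v(E), for every finite place v
  (hJmax : ∀ (W : WeierstrassCurve ℚ) [W.IsElliptic] [W.IsGloballyMinimal] [NeZero (W.conductorNorm ℤ)]
    (K : Type) [Field K] [NumberField K]
    (Dt : ModularParametrizationData W (W.conductorNorm ℤ)) (β : ℤ) (ι : K →+* ℂ),
    W.analyticRank = 1 → W.HasMultiplicativeReductionAtPrime 3 → Surj W 3 →
    IsImaginaryQuadratic K → SatisfiesHeegnerHypothesis (W.conductorNorm ℤ) K →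
    Odd (NumberField.discr K) → (W.quadraticTwist (NumberField.discr K : ℚ)).entireLFunction 1 ≠ 0 →
    (4 * (W.conductorNorm ℤ : ℤ)) ∣ β ^ 2 - NumberField.discr K → ¬ (3 : ℤ) ∣ Dt.c →
    ∀ (v : HeightOneSpectrum (𝓞 ℚ)) (s : ℕ), s ≤ padicValNat 3 (W.tamagawaNumberAt v) →
      ∀ (n : ℕ) (d : KolyvaginHeegnerData Dt β ι n), Squarefree n →
        (∀ ℓ ∈ n.primeFactors, Zhang2014.IsKolyvaginPrime (W.conductorNorm ℤ) W K 3 ℓ ∧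
          s ≤ Zhang2014.kolyvaginIndex W 3 ℓ) → PDiv d 3 s)
  -- OPEN INPUT J₃ʳ♭ on MULTI-CARRIER curves only (ord₃ c_v < ord₃ ∏c for every v)
  (hJmulti : ∀ (W : WeierstrassCurve ℚ) [W.IsElliptic] [W.IsGloballyMinimal] [NeZero (W.conductorNorm ℤ)]
    (K : Type) [Field K] [NumberField K]
    (Dt : ModularParametrizationData W (W.conductorNorm ℤ)) (β : ℤ) (ι : K →+* ℂ),
    W.analyticRank = 1 → W.HasMultiplicativeReductionAtPrime 3 → Surj W 3 → Ram W 3 →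
    (∀ v : HeightOneSpectrum (𝓞 ℚ),
      padicValNat 3 (W.tamagawaNumberAt v) < padicValNat 3 W.tamagawaProduct) →
    IsImaginaryQuadratic K → SatisfiesHeegnerHypothesis (W.conductorNorm ℤ) K →
    Odd (NumberField.discr K) → (W.quadraticTwist (NumberField.discr K : ℚ)).entireLFunction 1 ≠ 0 →
    (4 * (W.conductorNorm ℤ : ℤ)) ∣ β ^ 2 - NumberField.discr K → ¬ (3 : ℤ) ∣ Dt.c →
    ∀ (s : ℕ), s ≤ padicValNat 3 W.tamagawaProduct →
      ∀ (n : ℕ) (d : KolyvaginHeegnerData Dt β ι n), Squarefree n →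
        (∀ ℓ ∈ n.primeFactors, Zhang2014.IsKolyvaginPrime (W.conductorNorm ℤ) W K 3 ℓ ∧
          s ≤ Zhang2014.kolyvaginIndex W 3 ℓ) → PDiv d 3 s)
  -- OPEN INPUT J₃⁰♭ on MULTI-CARRIER curves only
  (hJmulti0 : ∀ (W : WeierstrassCurve ℚ) [W.IsElliptic] [W.IsGloballyMinimal] [NeZero (W.conductorNorm ℤ)]
    (K : Type) [Field K] [NumberField K]
    (Dt : ModularParametrizationData W (W.conductorNorm ℤ)) (β : ℤ) (ι : K →+* ℂ),
    W.analyticRank = 1 → W.HasMultiplicativeReductionAtPrime 3 → Surj W 3 → ¬ Ram W 3 →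
    (∀ v : HeightOneSpectrum (𝓞 ℚ),
      padicValNat 3 (W.tamagawaNumberAt v) < padicValNat 3 W.tamagawaProduct) →
    IsImaginaryQuadratic K → SatisfiesHeegnerHypothesis (W.conductorNorm ℤ) K →
    Odd (NumberField.discr K) → (W.quadraticTwist (NumberField.discr K : ℚ)).entireLFunction 1 ≠ 0 →
    (4 * (W.conductorNorm ℤ : ℤ)) ∣ β ^ 2 - NumberField.discr K → ¬ (3 : ℤ) ∣ Dt.c →
    ∀ (s : ℕ), s ≤ padicValNat 3 W.tamagawaProduct →
      ∀ (n : ℕ) (d : KolyvaginHeegnerData Dt β ι n), Squarefree n →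
        (∀ ℓ ∈ n.primeFactors, Zhang2014.IsKolyvaginPrime (W.conductorNorm ℤ) W K 3 ℓ ∧
          s ≤ Zhang2014.kolyvaginIndex W 3 ℓ) → PDiv d 3 s)
  -- OPEN INPUT TL₃: the rank-0 3-part lower bound at a multiplicative 3, E[3] irreducible, NO (ram)
  (hTL : ∀ (V : WeierstrassCurve ℚ) [V.IsElliptic] [V.IsGloballyMinimal],
    V.HasMultiplicativeReductionAtPrime 3 → V.HasIrreducibleModPGaloisRep 3 →
    V.entireLFunction 1 ≠ 0 → Finite V.sha →
    ∃ q : ℚ, V.entireLFunction 1 / (V.realPeriodRat : ℂ) = (q : ℂ) ∧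
      padicValRat 3 q ≤ (padicValNat 3 V.shaOrder : ℤ) + padicValNat 3 V.tamagawaProduct -
        2 * padicValNat 3 V.torsionOrder)

/-! ### §1 Binder algebra: J₃ʳ♭ ∕ J₃⁰♭ from the MAX binder + the MULTI-CARRIER residue -/

include hJmax hJmulti in
/-- **J₃ʳ♭ ⟸ `JetchevMaxHL` + J₃ʳ♭ on multi-carrier curves.** `hJmax` = Jetchev's Thm. 1.4
`m_∞ ≥ max_q ord_p c_q` READ at `3 ∥ N` (hypothesis; printed for `p ∤ N` only): on every Hoffstein–Luo-
type Manin-good conductor-`1` frame of a curve with `r_an = 1`, multiplicative at `3`, `ρ̄_{E,3}` onto,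
the derived Heegner points are `3^s`-divisible to every depth `s ≤ ord₃ c_v(E)`, every finite place `v`.
`hJmulti` = the J₃ʳ♭ divisibility (depth `ord₃ ∏c`) asked only on curves with `ord₃ c_v < ord₃ ∏c` for
every `v`. On a curve with a place `v` carrying the whole `3`-part of `∏c` the max binder at `v` gives
depth `ord₃ ∏c`. Case split on `∃ v, ord₃ ∏c ≤ ord₃ c_v`; no arithmetic of `∏c` is used. Conclusion =
the registered stub `stub_jetchevDivisibilityRamHLAtThree` VERBATIM. CONDITIONAL on both binders.
[cite: Jetchev2008, Thm. 1.4 and Cor. 1.5 (p. 812)] [cite: McCallumLMS1991, §5 Cor. 5.6 (p. 310)] -/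
theorem jetchevDivisibilityRamHL_of_jetchevMaxHL_of_multi :
    ∀ (W : WeierstrassCurve ℚ) [W.IsElliptic] [W.IsGloballyMinimal] [NeZero (W.conductorNorm ℤ)]
      (K : Type) [Field K] [NumberField K]
      (Dt : ModularParametrizationData W (W.conductorNorm ℤ)) (β : ℤ) (ι : K →+* ℂ),
      W.analyticRank = 1 → W.HasMultiplicativeReductionAtPrime 3 → Surj W 3 → Ram W 3 →
      IsImaginaryQuadratic K → SatisfiesHeegnerHypothesis (W.conductorNorm ℤ) K →
      Odd (NumberField.discr K) → (W.quadraticTwist (NumberField.discr K : ℚ)).entireLFunction 1 ≠ 0 →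
      (4 * (W.conductorNorm ℤ : ℤ)) ∣ β ^ 2 - NumberField.discr K → ¬ (3 : ℤ) ∣ Dt.c →
      ∀ (s : ℕ), s ≤ padicValNat 3 W.tamagawaProduct →
        ∀ (n : ℕ) (d : KolyvaginHeegnerData Dt β ι n), Squarefree n →
          (∀ ℓ ∈ n.primeFactors, Zhang2014.IsKolyvaginPrime (W.conductorNorm ℤ) W K 3 ℓ ∧
            s ≤ Zhang2014.kolyvaginIndex W 3 ℓ) → PDiv d 3 s := by
  intro W _ _ _ K _ _ Dt β ι hr hmult hρ hram hK hHN hodd hLt hβ hc s hs n d hn hℓ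
  by_cases hmono : ∃ v : HeightOneSpectrum (𝓞 ℚ),
      padicValNat 3 W.tamagawaProduct ≤ padicValNat 3 (W.tamagawaNumberAt v)
  · obtain ⟨v, hv⟩ := hmono
    exact hJmax W K Dt β ι hr hmult hρ hK hHN hodd hLt hβ hc v s (hs.trans hv) n d hn hℓ
  · push Not at hmono
    exact hJmulti W K Dt β ι hr hmult hρ hram hmono hK hHN hodd hLt hβ hc s hs n d hn hℓ

include hJmax hJmulti0 in
/-- **J₃⁰♭ ⟸ `JetchevMaxHL` + J₃⁰♭ on multi-carrier curves** (the same bookkeeping on ¬(ram) ∧ surj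
frames; conclusion = the registered stub `stub_jetchevDivisibilityNotRamHLAtThree` VERBATIM). CONDITIONAL.
[cite: Jetchev2008, Thm. 1.4 and Cor. 1.5 (p. 812)] [cite: McCallumLMS1991, §5 Cor. 5.6 (p. 310)] -/
theorem jetchevDivisibilityNotRamHL_of_jetchevMaxHL_of_multi :
    ∀ (W : WeierstrassCurve ℚ) [W.IsElliptic] [W.IsGloballyMinimal] [NeZero (W.conductorNorm ℤ)]
      (K : Type) [Field K] [NumberField K]
      (Dt : ModularParametrizationData W (W.conductorNorm ℤ)) (β : ℤ) (ι : K →+* ℂ),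
      W.analyticRank = 1 → W.HasMultiplicativeReductionAtPrime 3 → Surj W 3 → ¬ Ram W 3 →
      IsImaginaryQuadratic K → SatisfiesHeegnerHypothesis (W.conductorNorm ℤ) K →
      Odd (NumberField.discr K) → (W.quadraticTwist (NumberField.discr K : ℚ)).entireLFunction 1 ≠ 0 →
      (4 * (W.conductorNorm ℤ : ℤ)) ∣ β ^ 2 - NumberField.discr K → ¬ (3 : ℤ) ∣ Dt.c →
      ∀ (s : ℕ), s ≤ padicValNat 3 W.tamagawaProduct →
        ∀ (n : ℕ) (d : KolyvaginHeegnerData Dt β ι n), Squarefree n →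
          (∀ ℓ ∈ n.primeFactors, Zhang2014.IsKolyvaginPrime (W.conductorNorm ℤ) W K 3 ℓ ∧
            s ≤ Zhang2014.kolyvaginIndex W 3 ℓ) → PDiv d 3 s := by
  intro W _ _ _ K _ _ Dt β ι hr hmult hρ hnram hK hHN hodd hLt hβ hc s hs n d hn hℓ
  by_cases hmono : ∃ v : HeightOneSpectrum (𝓞 ℚ),
      padicValNat 3 W.tamagawaProduct ≤ padicValNat 3 (W.tamagawaNumberAt v)
  · obtain ⟨v, hv⟩ := hmono
    exact hJmax W K Dt β ι hr hmult hρ hK hHN hodd hLt hβ hc v s (hs.trans hv) n d hn hℓ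
  · push Not at hmono
    exact hJmulti0 W K Dt β ι hr hmult hρ hnram hmono hK hHN hodd hLt hβ hc s hs n d hn hℓ

/-! ### §2 The Tamagawa clauses on MONO-CARRIER curves from `JetchevMaxHL` alone -/

include hGZ hKo hSk hGZK hmod hnf hHL hMaz hrec hD36 hMcU hJmax in
/-- **X11b@3 ∧ (ram) ∧ MONO-CARRIER: the Euler-system half from `JetchevMaxHL` alone** (+ the published
facts of files 1–5). For a curve with `ClassX11b W 3`, a (ram) witness and ONE finite place `v` with
`ord₃ ∏_ℓ c_ℓ(E) ≤ ord₃ c_v(E)` (all carrier kinds at once: `v ∣ 3` split with `3 ∣ ord₃ Δ` (α), a split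
multiplicative `ℓ ≠ 3` (β), an additive IV/IV* place (γ)), `Typed.MissingUpperBoundAt W 3`. Proof = file 5
§1 (`missingUpperBoundAt_three_of_classX11b_of_ram_of_jetchevDivisibilityHL`) with the Jetchev binder
applied at the carrier `v` of THIS curve: one Hoffstein–Luo odd Heegner datum (Mazur: Manin-good), a
conductor-`1` Kolyvagin–Heegner datum (Darmon Thm. 3.6, Shimura reciprocity), the sharp bound over `K`
from depth-`ord₃ ∏c` divisibility + McCallum (file 1 §1), descent to `ℚ` by Skinner Thm. C for the (ram)
twist (x11b3). `M_∞`-currency twin of x11b3's `X11b.missingUpperBoundAt_of_classX11b_of_ram_of_monoCarrier`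
(Ш-currency binder `hJ`). CONDITIONAL on `hJmax`; nothing booked.
[cite: Jetchev2008, Thm. 1.4 and Cor. 1.5 (p. 812)] [cite: McCallumLMS1991, §5 Cor. 5.6 (p. 310)]
[cite: Skinner2016PacificMC, Thm. C (§1) and footnote 1] [cite: Darmon2004, Thm. 3.6 (PDF p. 43)]
[cite: HoffsteinLuo1997, Theorem (§1)] -/
theorem missingUpperBoundAt_three_of_classX11b_of_ram_of_monoCarrier_of_jetchevMaxHL
    (W : WeierstrassCurve ℚ) [W.IsElliptic] [W.IsGloballyMinimal]
    (hX : ClassX11b W 3) (hram : Ram W 3)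
    (hmono : ∃ v : HeightOneSpectrum (𝓞 ℚ),
      padicValNat 3 W.tamagawaProduct ≤ padicValNat 3 (W.tamagawaNumberAt v)) :
    Typed.MissingUpperBoundAt W 3 := by
  haveI : NeZero (W.conductorNorm ℤ) := ⟨(W.conductorNorm_pos_holds).ne'⟩
  obtain ⟨hr, h32, hmult, hirr⟩ := hX
  have hρ : Surj W 3 := surj_of_irr_of_ram W 3 hirr hram
  obtain ⟨v, hv⟩ := hmono
  -- ONE odd Heegner datum with a Manin-good frame (Hoffstein–Luo field; Mazur; w_K = 2)
  obtain ⟨K, _, _, Dt, H, ι, P, Wd, _, _, Cd, hK, hodd, h3d, hHN, hP, hc, hμ, hLt, hWd⟩ :=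
    exists_oddHeegnerData hnf hHL hMaz integral_neronScaling_of_isGloballyMinimal_holds W 3 hr h32
      hmult hirr
  have h3 : NumberField.discr K ≠ -3 := by
    intro h
    exact h3d (h ▸ ⟨-1, by norm_num⟩)
  have h4 : NumberField.discr K ≠ -4 := by
    intro h
    rw [h] at hodd
    exact (Int.not_odd_iff_even.mpr ⟨-2, by norm_num⟩) hodd
  -- a conductor-1 Kolyvagin–Heegner datum on the frame (Dt, H.β, ι) (Darmon 2004, Thm. 3.6)
  obtain ⟨d₁⟩ := exists_kolyvaginHeegnerData_one (hD36 _ W K) hK Dt H.β ι H.dvd_sq_sub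
  -- the bottom point: P(1) = y_K = P in E(K̄) (Shimura reciprocity at conductor 1)
  have hPd : d₁.toGeomPoints d₁.derivedPoint = toGeomPoints (W.baseChange K) P :=
    KolyvaginBottom.toGeomPoints_derivedPoint_one_eq (hrec _ W K) hK hHN hP d₁ rfl
  -- global divisibility to depth ord₃ ∏c on this frame: the max binder at the carrier v
  have hJW : ∀ (s : ℕ), s ≤ padicValNat 3 W.tamagawaProduct →
      ∀ (n : ℕ) (d : KolyvaginHeegnerData Dt H.β ι n), Squarefree n →
        (∀ ℓ ∈ n.primeFactors, Zhang2014.IsKolyvaginPrime (W.conductorNorm ℤ) W K 3 ℓ ∧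
          s ≤ Zhang2014.kolyvaginIndex W 3 ℓ) → PDiv d 3 s :=
    fun s hs n d hn hℓ ↦ hJmax W K Dt H.β ι hr hmult hρ hK hHN hodd hLt H.dvd_sq_sub hc v s
      (hs.trans hv) n d hn hℓ
  -- the sharpened bound over K at this datum, from the divisibility + McCallum (file 1 §1)
  have hU : Finite (W.baseChange K).sha → ¬ IsOfFinAddOrder P →
      padicValNat 3 (Nat.card (W.baseChange K).sha) + 2 * padicValNat 3 W.tamagawaProduct ≤
        2 * padicValNat 3 (AddSubgroup.zmultiples P).index := by
    intro hfin hPinf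
    haveI : Finite (W.baseChange K).sha := hfin
    -- rank one (Kolyvagin) and no 3-torsion (E[3] irreducible, K imaginary quadratic)
    obtain ⟨hrank, -⟩ := hKo (W.conductorNorm ℤ) W K hK hHN ⟨Dt, H, ι, hP⟩ hPinf
    have hbot := torsionBy_eq_bot_of_isImaginaryQuadratic_of_hasIrreducibleModPGaloisRep W K hK
      Nat.prime_three hirr
    have hiv : ∀ x : (W.baseChange K).toAffine.Point, 3 • x = 0 → x = 0 := fun x hx ↦ by
      have hmem : x ∈ AddSubgroup.torsionBy (W.baseChange K).toAffine.Point ((3 : ℕ) : ℤ) := by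
        rw [mem_torsionBy_iff, natCast_zsmul]
        exact hx
      rw [hbot] at hmem
      exact hmem
    exact shaIndexBound_sharp_three_of_globalDivisibility hMcU W K hmult hρ hK h3 h4 hHN Dt H.β ι d₁ P
      hPd hPinf hrank hiv hJW
  -- descent to ℚ: GZ bookkeeping, twist transports, Skinner Thm. C for E^{d_K} (x11b3)
  exact missingUpperBoundAt_of_sharpIndexBound_of_le W 3 K Dt H ι P (hGZ _ W K) (hKo _ W K) hSk hGZK
    hmod hr h32 hmult hirr hram hK hodd h3d hHN hP hc hμ hLt Wd Cd hWd (padicValNat 3 W.tamagawaProduct)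
    le_rfl hU

include hGZ hKo hGZK hmod hnf hHL hMaz hrec hD36 hMcU hJmax hTL in
/-- **X11b@3 ∧ surj ∧ MONO-CARRIER: the Euler-system half from `JetchevMaxHL` + TL₃** (+ the published
facts), with NO (ram) hypothesis: proof = file 5 §2 with the Jetchev binder applied at the carrier of THIS
curve; the descent to `ℚ` uses TL₃ for the twist (which does not ask (ram)). On ¬(ram) ∧ surj curves this
is clause (0) of the crux restricted to mono-carrier curves. CONDITIONAL on `hJmax` and TL₃.
[cite: Jetchev2008, Thm. 1.4 and Cor. 1.5 (p. 812)] [cite: McCallumLMS1991, §5 Cor. 5.6 (p. 310)]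
[cite: Skinner2016PacificMC, Thm. C (§1) — shape of TL₃ only] [cite: Darmon2004, Thm. 3.6 (PDF p. 43)] -/
theorem missingUpperBoundAt_three_of_classX11b_of_surj_of_monoCarrier_of_jetchevMaxHL_of_twistLower
    (W : WeierstrassCurve ℚ) [W.IsElliptic] [W.IsGloballyMinimal]
    (hX : ClassX11b W 3) (hρ : Surj W 3)
    (hmono : ∃ v : HeightOneSpectrum (𝓞 ℚ),
      padicValNat 3 W.tamagawaProduct ≤ padicValNat 3 (W.tamagawaNumberAt v)) :
    Typed.MissingUpperBoundAt W 3 := by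
  haveI : NeZero (W.conductorNorm ℤ) := ⟨(W.conductorNorm_pos_holds).ne'⟩
  obtain ⟨hr, h32, hmult, hirr⟩ := hX
  obtain ⟨v, hv⟩ := hmono
  -- ONE odd Heegner datum with a Manin-good frame (Hoffstein–Luo field; Mazur; w_K = 2)
  obtain ⟨K, _, _, Dt, H, ι, P, Wd, _, _, Cd, hK, hodd, h3d, hHN, hP, hc, hμ, hLt, hWd⟩ :=
    exists_oddHeegnerData hnf hHL hMaz integral_neronScaling_of_isGloballyMinimal_holds W 3 hr h32
      hmult hirr
  have h3 : NumberField.discr K ≠ -3 := by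
    intro h
    exact h3d (h ▸ ⟨-1, by norm_num⟩)
  have h4 : NumberField.discr K ≠ -4 := by
    intro h
    rw [h] at hodd
    exact (Int.not_odd_iff_even.mpr ⟨-2, by norm_num⟩) hodd
  -- a conductor-1 Kolyvagin–Heegner datum on the frame (Dt, H.β, ι), with bottom point y_K = P
  obtain ⟨d₁⟩ := exists_kolyvaginHeegnerData_one (hD36 _ W K) hK Dt H.β ι H.dvd_sq_sub
  have hPd : d₁.toGeomPoints d₁.derivedPoint = toGeomPoints (W.baseChange K) P :=
    KolyvaginBottom.toGeomPoints_derivedPoint_one_eq (hrec _ W K) hK hHN hP d₁ rfl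
  -- global divisibility to depth ord₃ ∏c on this frame: the max binder at the carrier v
  have hJW : ∀ (s : ℕ), s ≤ padicValNat 3 W.tamagawaProduct →
      ∀ (n : ℕ) (d : KolyvaginHeegnerData Dt H.β ι n), Squarefree n →
        (∀ ℓ ∈ n.primeFactors, Zhang2014.IsKolyvaginPrime (W.conductorNorm ℤ) W K 3 ℓ ∧
          s ≤ Zhang2014.kolyvaginIndex W 3 ℓ) → PDiv d 3 s :=
    fun s hs n d hn hℓ ↦ hJmax W K Dt H.β ι hr hmult hρ hK hHN hodd hLt H.dvd_sq_sub hc v s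
      (hs.trans hv) n d hn hℓ
  -- the sharpened bound over K at this datum, from the divisibility + McCallum (file 1 §1)
  have hU : Finite (W.baseChange K).sha → ¬ IsOfFinAddOrder P →
      padicValNat 3 (Nat.card (W.baseChange K).sha) + 2 * padicValNat 3 W.tamagawaProduct ≤
        2 * padicValNat 3 (AddSubgroup.zmultiples P).index := by
    intro hfin hPinf
    haveI : Finite (W.baseChange K).sha := hfin
    obtain ⟨hrank, -⟩ := hKo (W.conductorNorm ℤ) W K hK hHN ⟨Dt, H, ι, hP⟩ hPinf
    have hbot := torsionBy_eq_bot_of_isImaginaryQuadratic_of_hasIrreducibleModPGaloisRep W K hK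
      Nat.prime_three hirr
    have hiv : ∀ x : (W.baseChange K).toAffine.Point, 3 • x = 0 → x = 0 := fun x hx ↦ by
      have hmem : x ∈ AddSubgroup.torsionBy (W.baseChange K).toAffine.Point ((3 : ℕ) : ℤ) := by
        rw [mem_torsionBy_iff, natCast_zsmul]
        exact hx
      rw [hbot] at hmem
      exact hmem
    exact shaIndexBound_sharp_three_of_globalDivisibility hMcU W K hmult hρ hK h3 h4 hHN Dt H.β ι d₁ P
      hPd hPinf hrank hiv hJW
  -- the twist: transports (no (ram) needed) and TL₃ at its minimal model
  have hD0 : (NumberField.discr K : ℚ) ≠ 0 := by exact_mod_cast NumberField.discr_ne_zero K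
  haveI hEt : (W.quadraticTwist (NumberField.discr K : ℚ)).IsElliptic :=
    W.isElliptic_quadraticTwist hD0
  have hmultd : Wd.HasMultiplicativeReductionAtPrime 3 :=
    hasMultiplicativeReductionAtPrime_twist_of_heegner' W 3 K hK hHN hmult Cd hWd
  have hirrd : Wd.HasIrreducibleModPGaloisRep 3 :=
    hasIrreducibleModPGaloisRep_twist_model W 3 K hK.1 hirr Cd hWd
  have htam : padicValNat 3 Wd.tamagawaProduct = padicValNat 3 W.tamagawaProduct :=
    X2.padicValNat_tamagawaProduct_twist_of_heegner_of_odd W 3 h32 K hK hodd h3d hHN Cd hWd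
  have hu : padicValRat 3 (Cd.u : ℚ) = 0 :=
    padicValRat_u_eq_zero_of_twist_minimal W 3 K hK hHN hmult Cd hWd
  have hLt' : (W.quadraticTwist (NumberField.discr K : ℚ)).entireLFunction = Wd.entireLFunction := by
    rw [← hWd, entireLFunction_smul]
  have hLd1 : Wd.entireLFunction 1 ≠ 0 := by rw [← hLt']; exact hLt
  have hfinSd : Finite Wd.sha := (hGZK Wd (by
    rw [(Wd.analyticRank_eq_zero_iff_holds (hmod Wd)).2 hLd1]; omega)).2
  obtain ⟨qd, hqd, hvqd⟩ := hTL Wd hmultd hirrd hLd1 hfinSd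
  -- descent to ℚ (x11b3's data-level arithmetic)
  exact missingUpperBoundAt_of_shaIndexBound_sharp W 3 (W.conductorNorm ℤ) K Dt H ι P (hGZ _ W K)
    (hKo _ W K) hGZK hmod hK hHN hP h32 hc hμ hr hLt Wd Cd hWd hu htam le_rfl ⟨qd, hqd, hvqd⟩ hU

include hGZ hKo hSk hGZK hmod hnf hHL hMaz hrec hD36 hMcU hJmax hTL in
/-- **The crux's three clauses VERBATIM on MONO-CARRIER curves, from `JetchevMaxHL` + TL₃** (+ the
published facts): for every minimal `W` with `ClassX11b W 3` and ONE finite place carrying the `3`-part of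
`∏c`, the (α) clause, the (γ∖α)-split clause and the ¬(ram) ∧ surj clause of
`Theses.ClassRecordThree.EulerHalvesAtThree`. This is the statement a split item «EulerHalvesAtThree on
mono-carrier curves» would carry; its only open inputs are the READING `JetchevMaxHL` and (clause (0))
TL₃. Census pointer (x11b3, evidence only): 160 of the 567 TRUE-OPEN (T2′)@3 classes are mono-carrier
(α 37 · β 76 · γ 47). CONDITIONAL; nothing booked. [cite: Jetchev2008, Thm. 1.4 and Cor. 1.5 (p. 812)]
[cite: McCallumLMS1991, §5 Cor. 5.6 (p. 310)] [cite: Skinner2016PacificMC, Thm. C (§1)] -/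
theorem eulerHalvesAtThree_monoCarrier_of_jetchevMaxHL_of_twistLower :
    ∀ (W : WeierstrassCurve ℚ) [W.IsElliptic] [W.IsGloballyMinimal], ClassX11b W 3 →
      (∃ v : HeightOneSpectrum (𝓞 ℚ),
        padicValNat 3 W.tamagawaProduct ≤ padicValNat 3 (W.tamagawaNumberAt v)) →
      (Ram W 3 → ShapeAlpha W → Typed.MissingUpperBoundAt W 3) ∧
      (Ram W 3 → W.HasSplitMultiplicativeReductionAtPrime 3 → ¬ ShapeAlpha W → ShapeGamma W →
        Typed.MissingUpperBoundAt W 3) ∧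
      (Surj W 3 → ¬ Ram W 3 → Typed.MissingUpperBoundAt W 3) := by
  intro W _ _ hX hmono
  refine ⟨fun hram _ ↦ ?_, fun hram _ _ _ ↦ ?_, fun hρ _ ↦ ?_⟩
  · exact missingUpperBoundAt_three_of_classX11b_of_ram_of_monoCarrier_of_jetchevMaxHL hGZ hKo hSk hGZK
      hmod hnf hHL hMaz hrec hD36 hMcU hJmax W hX hram hmono
  · exact missingUpperBoundAt_three_of_classX11b_of_ram_of_monoCarrier_of_jetchevMaxHL hGZ hKo hSk hGZK
      hmod hnf hHL hMaz hrec hD36 hMcU hJmax W hX hram hmono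
  · exact missingUpperBoundAt_three_of_classX11b_of_surj_of_monoCarrier_of_jetchevMaxHL_of_twistLower
      hGZ hKo hGZK hmod hnf hHL hMaz hrec hD36 hMcU hJmax hTL W hX hρ hmono

/-! ### §3 The crux BY NAME from {`JetchevMaxHL`, J₃ʳ♭-multi, J₃⁰♭-multi, TL₃} -/

include hGZ hKo hSk hGZK hmod hnf hHL hMaz hrec hD36 hMcU hJmax hJmulti hJmulti0 hTL in
/-- **Item 19109 `EulerHalvesAtThree` BY NAME from the published named facts and exactly
{`JetchevMaxHL` (reading-shaped), J₃ʳ♭ on multi-carrier curves, J₃⁰♭ on multi-carrier curves, TL₃}** —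
file 5 §3 (`classRecordThree_eulerHalvesAtThree_of_jetchevDivisibilityHL_of_twistLower`) precomposed with
§1. The mono-carrier part of the Tamagawa clauses is thereby served by ONE binder of the exact shape of
Jetchev's Thm. 1.4 transported to `3 ∥ N`; the open residue is J₃ on multi-carrier Hoffstein–Luo frames
(where every printed Kolyvagin-system method gives only the maximum: Jetchev Cor. 1.5; Büyükboduk 2008
Questions 1–2 and §4.2; the sum is in print only via a main conjecture, BCGS 2023 Thm. 2 at good
ordinary `p > 3`) and TL₃. CONDITIONAL on every binder; the item does NOT close by this theorem.
[cite: Jetchev2008, Thm. 1.4 and Cor. 1.5 (p. 812)] [cite: McCallumLMS1991, §5 Cor. 5.6 (p. 310)]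
[cite: Skinner2016PacificMC, Thm. C (§1)] -/
theorem classRecordThree_eulerHalvesAtThree_of_jetchevMaxHL_of_multi_of_twistLower :
    Summit.BirchSwinnertonDyer.BirchSwinnertonDyer.Theses.ClassRecordThree.EulerHalvesAtThree :=
  classRecordThree_eulerHalvesAtThree_of_jetchevDivisibilityHL_of_twistLower hGZ hKo hSk hGZK hmod hnf hHL
    hMaz hrec hD36 hMcU (jetchevDivisibilityRamHL_of_jetchevMaxHL_of_multi hJmax hJmulti)
    (jetchevDivisibilityNotRamHL_of_jetchevMaxHL_of_multi hJmax hJmulti0) hTL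

include hGZ hKo hSk hGZK hmod hnf hHL hMaz hrec hD36 hMcU hJmax hJmulti hJmulti0 hTL in
/-- **The shared decl of route `KolyvaginRoadThree` (same statement) from the same inputs.** [folklore] -/
theorem kolyvaginRoadThree_eulerHalvesAtThree_of_jetchevMaxHL_of_multi_of_twistLower :
    Summit.BirchSwinnertonDyer.BirchSwinnertonDyer.Theses.KolyvaginRoadThree.EulerHalvesAtThree :=
  classRecordThree_eulerHalvesAtThree_of_jetchevMaxHL_of_multi_of_twistLower hGZ hKo hSk hGZK hmod hnf hHL
    hMaz hrec hD36 hMcU hJmax hJmulti hJmulti0 hTL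

end Binders

end Summit.BirchSwinnertonDyer.Rank1Residual.X11b.Three.Koly

end
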